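import Summits.QuantumFields.YangMills.Theorems.BalabanUVNodesN19VacuumMGFRoad
import Summits.QuantumFields.YangMills.Theorems.BalabanUVNodesN14TiltedMatching
import Summits.QuantumFields.YangMills.Theorems.BalabanUVNodesN20Knit
import Summits.QuantumFields.YangMills.Theorems.BalabanUVNodesN21ShellWeightKnit

/-!
# BalabanUVNodes ∕ N19 at cluster K5 «SpineMatching» — ON THE MGF ROAD K5 IS A VACUUM CLUSTER: the DRESSED `HybridNE7` datum and the K5
# stubs `S_N19 ∧ S_N20 ∧ S_N21 ∧ S_U4` from the VACUUM (t-idle) node shapes N19⁰ ∧ N20⁰ ∧ N21⁰ ∧ U4′, the MGF forms, the room, and N14's `η`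

Cell `pub-ymgap` (HUMAN RULING D-0062, Track A), node N19 = NE7, R134 seat `pub-ymgap-dag-n19-c` (g5), route `Summits/QuantumFields/YangMills/Theses/
BalabanUVNodes.lean` rev 15, cluster item K3′ «SpineGivenEndpointR12» (stmt-QuantumFields-19908); filed `--supports` that item `--as helper`.  COUNT-NEUTRAL.
ROW VL-K5 of the lens seat `ym-lens-BalabanUVNodes-decomp` (g4)'s `LENS-decomp.md` v4 (M18, §v4.4), placed on this seat by dag-lead DEDUP-230, with the
two sibling readings at N20 ∕ N21 declared here (one declarer).  §1's third theorem is the LIFT, statement and proof token for token, of §5 of the lens's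
farm-checked sketch `LensDecompNE7v4.sketch.lean` (sha16 b90d49dc05091502; AUTHORSHIP: planner-ym-lens-BalabanUVNodes-decomp-g4); the rest is this
seat's.  THEOREMS ONLY; no Theses import; edits nothing (`DressedMGFForm`, `DressedSizeDomination`, `N14TiltedMatching`, `N20Knit`, `N21ShellWeightKnit`,
`N19VacuumMGFRoad`, `N19AtSpineCarriers`, `ClustersCore` stay as filed; every cited lemma is used BY NAME).

THE POINT.  Cluster K5 «SpineMatching» asks, at the spine carriers of record `S : YMDAG.UVSplit.SpineCarriers`, the three estimate-bearing node stubs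
N19 `Spine.NE7.Core` (shell-free cores), N20 `T4WeightBudget.RelWeightBound` (bad-class weight), N21 `T4IndicatorShell.ShellWeightBound` (shell weight)
and the letters U4′ (`W + Wsh < 1`, `Summable δ`) of the two runs' DRESSED term families `S.A`, `S.B` (source `t`, `|t| ≤ l₀`); `NE7.hybridNE7_of_core`
assembles them into `T4MatchingAssembly.HybridNE7`.  dag-n19-d g5's `N19VacuumMGFRoad` (lens ROW VL) typed the N19 JOIN: when the dressed shell-free cores
are in MGF FORM (`NE1p.DressedMGFForm.MGFForm`, the `pub-balaban-gaps` ne1 lineage's reading of NE1′'s t-structure) the dressed `Core` follows from the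
VACUUM `Core` (the t-idle cores `(K, t, τ) ↦ S.A K 0 τ − S.shA K 0 τ`) plus N14's residual binder `DressedMGFForm.TiltedMeanMatching η` — remainder
`δ⁰ + (l₀∕vol)·η`.  THIS FILE is the same one level up (lens card M18): the MGF road enters BELOW the K5 stubs, node by node, and on it ALL THREE K5
nodes are VACUUM nodes —
* N20: the dressed `RelWeightBound` with weights `e^{2l₀Bo}·W₀` ⇐ the VACUUM `RelWeightBound … W₀` + MGF forms of both runs' term families + the gen-0
  room `e^{2l₀Bo}·W₀ K < 1` (`DressedSizeDomination.relWeightBound_of_dominated` ∘ `MGFForm.termDominated`; §1);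
* N21: the dressed `ShellWeightBound` with weights `e^{2l₀Bo}·Wsh₀` ⇐ the VACUUM one + MGF forms of terms AND shell parts over sub-measures
  (`shellWeightBound_of_dominated`; §1) — both halves were hidden inside `DressedMGFForm.hybridNE7_of_mgfForm`'s proof and are exposed here at node level;
* K5: the dressed `HybridNE7` datum ⇐ N19⁰ ∧ N20⁰ ∧ N21⁰ ∧ U4′ + MGF forms + room + `η` (§1, the lens's §5), and with `η` PRODUCED by N14's decl of record
  `NE1p.DressedRoot.DressedStabilityStrict 𝒯 Λ` through `N14.hybridNE7_dressed_of_n14` (§2);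
* at the spine carriers: `S_N20 SRec`, `S_N21 SRec`, `S_U4 SRec` from per-bundle VACUUM readings with the record's weight slots as pinned majorants
  (`N20Knit.relWeightBound_mono_weight`, `N21ShellWeightKnit.shellWeightBound_mono`), and the JOINT reading `S_N19 SRec Inputs ∧ S_N20 SRec ∧ S_N21 SRec ∧
  S_U4 SRec` from ONE per-bundle vacuum-K5 + MGF + tilted-matching reading under the `deltaOfRecord` pin (dag-n19-d's `s_N19_of_vacuumCoreMGFReading` ∕
  `coreEdge_of_coreZero_mgfForm` BY NAME for the N19 conjunct; §3).
The observable enters K5 ONLY through the MGF forms (N27x ∕ NODE 00's `mgfForm_of_density` ∕ `.sub`), the room, and N14's `η`.  `Spine` ∕ `SpineDatum` ∕ N27 ∕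
`spineGivenEndpointR12_of_*` are untouched: this is not a rival cluster road (dag-lead FAN-OUT v1.3).

CONTENTS.
* §1 `relWeightBound_dressed_of_vacuum_mgfForm` (N20 transfer) · `shellWeightBound_dressed_of_vacuum_mgfForm` (N21 transfer) ·
  `hybridNE7_dressed_of_vacuumK5_mgfForm` (K5, the lens's §5 verbatim) · `target_dressed_of_vacuumK5_mgfForm` (node U5's exit on this road: the
  N19 row's DECL target `MatchingModConstants ∧ Summable` for the DRESSED partition functions, `NE7.target_of_hybridNE7` BY NAME).
* §2 `hybridNE7_dressed_of_vacuumK5_n14` (K5 with N14's decl of record by name).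
* §3 `s_N20_of_vacuumWeightMGFReading` · `s_N21_of_vacuumShellMGFReading` · `s_U4_of_vacuumRoomReading` · `k5_of_vacuumK5MGFReading` (joint).

HONEST FRAMING.  Kernel bookkeeping over hypothesis SHAPES already in the tree, cited BY NAME; the vacuum instance is a CHOICE OF INSTANCE for NODE O argued
cheaper by the lens, not a construction; NE7 ∕ NE7b ∕ NE7c ∕ NE1′ ([Balaban1989LargeFieldII] p. 356) NOT PRINTED as two-run statements for d = 4 and NOT
PROVED; every vacuum node shape, every MGF form, the room, `TiltedMeanMatching η` and every N14 binder are HYPOTHESES discharged by nobody here; nothing of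
Bałaban's densities is instantiated; N19 ∕ N20 ∕ N21 NOT discharged (0∕1 each); K3′ NOT claimed; counts UNMOVED (typed 28∕28 · discharged 5∕27 · A 5∕28);
one finite four-torus at fixed `ε = L^{−K}` — NOT ℝ⁴, NOT infinite volume, NOT OS, NOT a mass gap, NOT Clay.  0 `def`; 0 `sorry`; standard axioms; every
declaration is [folklore] ∕ [bookkeeping] and carries no cite tag.
-/

set_option autoImplicit false

noncomputable section

open Finset MeasureTheory ProbabilityTheory
open scoped BigOperators

namespace Summit.QuantumFields.YangMills.BalabanUVNodes.N19VacuumK5MGFRoad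

open Literature.MathematicalPhysics.QuantumFieldTheory.Balaban1983to89
open Literature.MathematicalPhysics.QuantumFieldTheory.Balaban1983to89.T4WeightBudget (RelWeightBound)
open Literature.MathematicalPhysics.QuantumFieldTheory.Balaban1983to89.T4IndicatorShell (ShellWeightBound)
open Literature.MathematicalPhysics.QuantumFieldTheory.Balaban1983to89.T4MatchingAssembly (HybridNE7)
open Summit.QuantumFields.BalabanUV.T4Continuum.Spine
open Summit.QuantumFields.BalabanUV.T4Continuum.NE1p.DressedSizeDomination (TermDominated relWeightBound_of_dominated shellWeightBound_of_dominated)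
open Summit.QuantumFields.BalabanUV.T4Continuum.NE1p.DressedMGFForm
open Summit.QuantumFields.YangMills.BalabanUVNodes.N19AtSpineCarriers (deltaOfRecord summable_delta_of_pin)
open Summit.QuantumFields.YangMills.BalabanUVNodes.N19VacuumMGFRoad (coreEdge_of_coreZero_mgfForm s_N19_of_vacuumCoreMGFReading)
open Summit.QuantumFields.YangMills.BalabanUVNodes.N20Knit (relWeightBound_mono_weight)
open Summit.QuantumFields.YangMills.Theorems (shellWeightBound_mono)
open YMDAG.UVSplit (SpineCarriers SpineRecordPred InputsPred S_N19 S_N20 S_N21 S_U4)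

/-! ## §1 The K5 node shapes, vacuum → dressed under MGF forms: N20, N21, and the `HybridNE7` datum -/

section Transfer

variable {ι : Type*} [DecidableEq ι] {Ω Ω' : ℕ → Type*} [∀ K, MeasurableSpace (Ω K)] [∀ K, MeasurableSpace (Ω' K)]
  {Bo l₀ vol : ℝ} {T : ℕ → Finset ι} {Bad : ℕ → ℝ → Finset ι} {Fo : ∀ K, Ω K → ℝ} {ν νsh : ∀ K, ι → Measure (Ω K)}
  {Fo' : ∀ K, Ω' K → ℝ} {ν' νsh' : ∀ K, ι → Measure (Ω' K)} {A B shA shB : ℕ → ℝ → ι → ℝ} {W₀ Wsh₀ δ₀ η : ℕ → ℝ}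

omit [DecidableEq ι] in
/-- **N20, VACUUM → DRESSED** [bookkeeping].  Both runs' dressed term families in MGF form (`A K t τ = ∫ e^{t·Fo K} dν K τ`, `|Fo K| ≤ Bo`; `B`
likewise), the VACUUM relative weight bound `RelWeightBound l₀ T A⁰ B⁰ Bad W₀` of the t-idle families `A⁰ = (K, t, τ) ↦ A K 0 τ`, `B⁰` likewise
(= what row NE7b produces WITHOUT the observable), `0 ≤ l₀`, and the gen-0 room `e^{2l₀Bo}·W₀ K < 1` ⇒ the DRESSED runs carry
`RelWeightBound l₀ T A B Bad (e^{2l₀Bo}·W₀)` — same bad classes.  `relWeightBound_of_dominated` BY NAME on the two `MGFForm.termDominated` (birth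
constants `e^{∓l₀Bo}`, ratio `e^{2l₀Bo}` by `exp_div_exp_neg`); the N20 half of `hybridNE7_of_mgfForm`'s proof, exposed.  NOT NE7b. -/
theorem relWeightBound_dressed_of_vacuum_mgfForm (hl₀ : 0 ≤ l₀) (hA : MGFForm Bo T Fo ν A) (hB : MGFForm Bo T Fo' ν' B)
    (hW₀ : RelWeightBound l₀ T (fun K _ τ => A K 0 τ) (fun K _ τ => B K 0 τ) Bad W₀)
    (hroom : ∀ K, Real.exp (2 * l₀ * Bo) * W₀ K < 1) :
    RelWeightBound l₀ T A B Bad (fun K => Real.exp (2 * l₀ * Bo) * W₀ K) := by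
  have hm : 0 < Real.exp (-(l₀ * Bo)) := Real.exp_pos _
  have hmM : Real.exp (-(l₀ * Bo)) ≤ Real.exp (l₀ * Bo) := Real.exp_le_exp.mpr (by nlinarith [hA.nonneg])
  have hratio := exp_div_exp_neg l₀ Bo
  have hroom' : ∀ K, Real.exp (l₀ * Bo) / Real.exp (-(l₀ * Bo)) * W₀ K < 1 := fun K => hratio ▸ hroom K
  rw [← hratio]
  exact relWeightBound_of_dominated (A₀ := fun K τ => A K 0 τ) (B₀ := fun K τ => B K 0 τ) hm hmM hW₀ (hA.termDominated l₀)
    (hB.termDominated l₀) hroom'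

omit [DecidableEq ι] in
/-- **N21, VACUUM → DRESSED** [bookkeeping].  Both runs' dressed term families AND their shell parts in MGF form, the shell parts over SUB-measures
(`νsh K τ ≤ ν K τ` — a shell part of a term is the total of a sub-family of its integrand), the VACUUM shell-weight bound
`ShellWeightBound l₀ T A⁰ B⁰ shA⁰ shB⁰ Wsh₀` of the t-idle families (= what row NE7c produces WITHOUT the observable), `0 ≤ l₀` ⇒ the DRESSED runs carry
`ShellWeightBound l₀ T A B shA shB (e^{2l₀Bo}·Wsh₀)`.  `shellWeightBound_of_dominated` BY NAME on four `MGFForm.termDominated`, with `sh ≤ term` for the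
dressed families from `MGFForm.sub` (the core over the difference measure is an MGF, hence nonnegative); the N21 half of `hybridNE7_of_mgfForm`'s proof,
exposed.  No room is needed here.  NOT NE7c. -/
theorem shellWeightBound_dressed_of_vacuum_mgfForm (hl₀ : 0 ≤ l₀) (hA : MGFForm Bo T Fo ν A) (hB : MGFForm Bo T Fo' ν' B)
    (hshA : MGFForm Bo T Fo νsh shA) (hshB : MGFForm Bo T Fo' νsh' shB)
    (hleA : ∀ K, ∀ τ ∈ T K, νsh K τ ≤ ν K τ) (hleB : ∀ K, ∀ τ ∈ T K, νsh' K τ ≤ ν' K τ)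
    (hSh₀ : ShellWeightBound l₀ T (fun K _ τ => A K 0 τ) (fun K _ τ => B K 0 τ) (fun K _ τ => shA K 0 τ)
      (fun K _ τ => shB K 0 τ) Wsh₀) :
    ShellWeightBound l₀ T A B shA shB (fun K => Real.exp (2 * l₀ * Bo) * Wsh₀ K) := by
  have hm : 0 < Real.exp (-(l₀ * Bo)) := Real.exp_pos _
  have hmM : Real.exp (-(l₀ * Bo)) ≤ Real.exp (l₀ * Bo) := Real.exp_le_exp.mpr (by nlinarith [hA.nonneg])
  have hratio := exp_div_exp_neg l₀ Bo
  -- `sh ≤ term` for the dressed families: the core `A − shA` is the MGF over the difference measure, hence nonnegative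
  have hleA' : ∀ K t, |t| ≤ l₀ → ∀ τ ∈ T K, shA K t τ ≤ A K t τ := fun K t _ τ hτ => by
    have h := (hA.sub hshA hleA).nonneg' K t hτ; linarith
  have hleB' : ∀ K t, |t| ≤ l₀ → ∀ τ ∈ T K, shB K t τ ≤ B K t τ := fun K t _ τ hτ => by
    have h := (hB.sub hshB hleB).nonneg' K t hτ; linarith
  rw [← hratio]
  exact shellWeightBound_of_dominated (A₀ := fun K τ => A K 0 τ) (B₀ := fun K τ => B K 0 τ)
    (shA₀ := fun K τ => shA K 0 τ) (shB₀ := fun K τ => shB K 0 τ) hm hmM hSh₀ (hA.termDominated l₀) (hB.termDominated l₀)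
    (hshA.termDominated l₀) (hshB.termDominated l₀) hleA' hleB'

/-- **K5 — ON THE MGF ROAD ALL THREE K5 NODES ARE VACUUM NODES** [bookkeeping].  The VACUUM K5 datum — N20⁰ `RelWeightBound` and N21⁰ `ShellWeightBound`
of the t-idle term families with `W₀ + Wsh₀ < 1`, N19⁰ `Spine.NE7.Core` of the t-idle shell-free cores with `Summable δ⁰` —, MGF forms of both runs'
dressed term families and of their shell parts over sub-measures, the gen-0 room `e^{2l₀Bo}(W₀ + Wsh₀) < 1`, and N14's binder on the SHELL-FREE
measures with `Summable η` ⇒ the DRESSED runs' `T4MatchingAssembly.HybridNE7` datum (weights `× e^{2l₀Bo}`, same bad classes, remainder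
`δ⁰ + (l₀∕vol)·η`) — `NE7.hybridNE7_of_core` ∘ `DressedMGFForm.hybridNE7_of_mgfForm` BY NAME.  This is the `h₀`-consumer
`N14.hybridNE7_dressed_of_n14` wants, with `h₀` ASSEMBLED from the three vacuum node shapes.  (Lens v4 sketch §5, verbatim.)  NOT NE7. -/
theorem hybridNE7_dressed_of_vacuumK5_mgfForm (hvol : 0 < vol) (hl₀ : 0 ≤ l₀)
    (hA : MGFForm Bo T Fo ν A) (hB : MGFForm Bo T Fo' ν' B) (hshA : MGFForm Bo T Fo νsh shA) (hshB : MGFForm Bo T Fo' νsh' shB)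
    (hleA : ∀ K, ∀ τ ∈ T K, νsh K τ ≤ ν K τ) (hleB : ∀ K, ∀ τ ∈ T K, νsh' K τ ≤ ν' K τ)
    (hW₀ : RelWeightBound l₀ T (fun K _ τ => A K 0 τ) (fun K _ τ => B K 0 τ) Bad W₀)
    (hSh₀ : ShellWeightBound l₀ T (fun K _ τ => A K 0 τ) (fun K _ τ => B K 0 τ) (fun K _ τ => shA K 0 τ)
      (fun K _ τ => shB K 0 τ) Wsh₀)
    (hlt : ∀ K, W₀ K + Wsh₀ K < 1) (hδ₀ : Summable δ₀)
    (hcore₀ : NE7.Core l₀ vol T Bad (fun K _ τ => A K 0 τ - shA K 0 τ) (fun K _ τ => B K 0 τ - shB K 0 τ) δ₀)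
    (hroom : ∀ K, Real.exp (2 * l₀ * Bo) * (W₀ K + Wsh₀ K) < 1)
    (hη : TiltedMeanMatching l₀ T Bad Fo (fun K τ => ν K τ - νsh K τ) Fo' (fun K τ => ν' K τ - νsh' K τ) η)
    (hηs : Summable η) :
    HybridNE7 l₀ vol T A B Bad (fun K => Real.exp (2 * l₀ * Bo) * W₀ K) shA shB
      (fun K => Real.exp (2 * l₀ * Bo) * Wsh₀ K) (fun K => δ₀ K + l₀ / vol * η K) :=
  hybridNE7_of_mgfForm hvol hl₀ hA hB hshA hshB hleA hleB (NE7.hybridNE7_of_core hW₀ hSh₀ hlt hδ₀ hcore₀) hroom hη hηs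

/-- **NODE U5's EXIT ON THIS ROAD — THE N19 ROW's DECL TARGET OF RECORD** [bookkeeping] (NODE-TABLE row n19: `T4CauchySum.MatchingModConstants vol l₀ δ Z
∧ Summable δ` ⇐ `T4MatchingAssembly.HybridNE7` via `.matchingModConstants`): the VACUUM K5 datum + MGF forms + room + N14's `η` as above, plus the dictionary
«`Z K t`, `Z (K+1) t` ARE the class sums of the two runs' dressed terms» (node N27x ∕ E1–E2) and run A's positivity, give `Spine.NE7.Target vol l₀ δ′ Z` —
matching of the DRESSED partition functions modulo constants with the summable remainder `δ′ = hybridDelta vol (δ⁰ + (l₀∕vol)·η) (e^{2l₀Bo}·W₀ + e^{2l₀Bo}·Wsh₀)`.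
`NE7.target_of_hybridNE7` ∘ `hybridNE7_dressed_of_vacuumK5_mgfForm`, BY NAME.  CONDITIONAL on every binder; NOT NE7. -/
theorem target_dressed_of_vacuumK5_mgfForm {Z : ℕ → ℝ → ℝ} (hvol : 0 < vol) (hl₀ : 0 ≤ l₀)
    (hA : MGFForm Bo T Fo ν A) (hB : MGFForm Bo T Fo' ν' B) (hshA : MGFForm Bo T Fo νsh shA) (hshB : MGFForm Bo T Fo' νsh' shB)
    (hleA : ∀ K, ∀ τ ∈ T K, νsh K τ ≤ ν K τ) (hleB : ∀ K, ∀ τ ∈ T K, νsh' K τ ≤ ν' K τ)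
    (hW₀ : RelWeightBound l₀ T (fun K _ τ => A K 0 τ) (fun K _ τ => B K 0 τ) Bad W₀)
    (hSh₀ : ShellWeightBound l₀ T (fun K _ τ => A K 0 τ) (fun K _ τ => B K 0 τ) (fun K _ τ => shA K 0 τ)
      (fun K _ τ => shB K 0 τ) Wsh₀)
    (hlt : ∀ K, W₀ K + Wsh₀ K < 1) (hδ₀ : Summable δ₀)
    (hcore₀ : NE7.Core l₀ vol T Bad (fun K _ τ => A K 0 τ - shA K 0 τ) (fun K _ τ => B K 0 τ - shB K 0 τ) δ₀)
    (hroom : ∀ K, Real.exp (2 * l₀ * Bo) * (W₀ K + Wsh₀ K) < 1)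
    (hη : TiltedMeanMatching l₀ T Bad Fo (fun K τ => ν K τ - νsh K τ) Fo' (fun K τ => ν' K τ - νsh' K τ) η)
    (hηs : Summable η)
    (hZA : ∀ K t, |t| ≤ l₀ → Z K t = ∑ τ ∈ T K, A K t τ) (hZB : ∀ K t, |t| ≤ l₀ → Z (K + 1) t = ∑ τ ∈ T K, B K t τ)
    (hpos : ∀ K t, |t| ≤ l₀ → 0 < ∑ τ ∈ T K, A K t τ) :
    NE7.Target vol l₀ (T4HybridMatching.hybridDelta vol (fun K => δ₀ K + l₀ / vol * η K)
      (fun K => Real.exp (2 * l₀ * Bo) * W₀ K + Real.exp (2 * l₀ * Bo) * Wsh₀ K)) Z :=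
  NE7.target_of_hybridNE7 (hybridNE7_dressed_of_vacuumK5_mgfForm hvol hl₀ hA hB hshA hshB hleA hleB hW₀ hSh₀ hlt hδ₀ hcore₀ hroom hη hηs)
    hvol hl₀ hZA hZB hpos

end Transfer

/-! ## §2 The same with `η` PRODUCED by N14's decl of record `DressedStabilityStrict 𝒯 Λ` — `N14.hybridNE7_dressed_of_n14` BY NAME -/

section WithN14

open Literature.MathematicalPhysics.QuantumFieldTheory.Balaban1983to89.T4TermFormat
open Literature.MathematicalPhysics.QuantumFieldTheory.Balaban1983to89.T4RecentScale (Multiplicity)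
open Summit.QuantumFields.BalabanUV.T4Continuum.NE1p.DressedRoot
open Summit.QuantumFields.BalabanUV.T4Continuum.NE1p.DressedRootStrictSeparation
open Summit.QuantumFields.BalabanUV.T4Continuum.NE1p.TiltedMeanCrossover
open YMDAG.N14 (hybridNE7_dressed_of_n14)

variable {P : Type*} {𝒯 : DressedTower P} {ι D : Type*} [DecidableEq ι] {Ω Ω' : ℕ → Type*} [∀ K, MeasurableSpace (Ω K)]
  [∀ K, MeasurableSpace (Ω' K)] {l₀ vol : ℝ} {T : ℕ → Finset ι} {Bad : ℕ → ℝ → Finset ι} {F : ∀ K, Ω K → ℝ}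
  {ν νsh : ∀ K, ι → Measure (Ω K)} {F' : ∀ K, Ω' K → ℝ} {ν' νsh' : ∀ K, ι → Measure (Ω' K)} {wf : ℕ → ι → Finset D}
  {sc : ℕ → D → ℕ} {bA bB : ℕ → ℝ → ι → ℝ → ℝ} {ΔA ΔB : ℕ → ℝ → ι → ℝ → D → ℝ} {w : ℕ → ℝ}

/-- **K5 FROM THE VACUUM K5 DATUM AND N14's DECL OF RECORD, IN ONE THEOREM** [bookkeeping]: `N14.hybridNE7_dressed_of_n14` (dag-n14-a) with its
undressed-datum hypothesis `h₀ : HybridNE7 … (t = 0 families) … W₀ … Wsh₀ δ⁰` ASSEMBLED from the three VACUUM node shapes — N20⁰ `RelWeightBound … W₀`,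
N21⁰ `ShellWeightBound … Wsh₀`, U4′⁰ `W₀ + Wsh₀ < 1` ∧ `Summable δ⁰`, N19⁰ `Spine.NE7.Core … δ⁰` (`NE7.hybridNE7_of_core`).  The remaining binders are
N14's, displayed exactly as there: MGF forms of both runs' dressed families and shell parts over sub-measures, the room `e^{2l₀Bo}(W₀ + Wsh₀) < 1`, the
decl of record `NE1p.DressedRoot.DressedStabilityStrict 𝒯 Λ`, the `ScaleLedger` on the SHELL-FREE measures, the identifications ∕ dominations of slot
influences by booked sizes (both runs), the census `Multiplicity … Cw vol Λ`, the young rate `YoungInfluenceRate … C θ Λ′` with `0 < θ < 1`, `θ ≤ Λ′`,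
and summable base widths ⇒ `∃ η, Summable η ∧ HybridNE7 l₀ vol T A B Bad (e^{2l₀Bo}·W₀) shA shB (e^{2l₀Bo}·Wsh₀) (δ⁰ + (l₀∕vol)·η)` for the DRESSED
runs.  One application; nothing instantiated; NOT NE7, NOT NE1′. -/
theorem hybridNE7_dressed_of_vacuumK5_n14 {Bo Λ Cw C θ Λ' : ℝ} {A B shA shB : ℕ → ℝ → ι → ℝ} {W₀ Wsh₀ δ₀ : ℕ → ℝ}
    (hvol : 0 < vol) (hl₀ : 0 ≤ l₀)
    (hA : MGFForm Bo T F ν A) (hB : MGFForm Bo T F' ν' B) (hshA : MGFForm Bo T F νsh shA) (hshB : MGFForm Bo T F' νsh' shB)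
    (hleA : ∀ K, ∀ τ ∈ T K, νsh K τ ≤ ν K τ) (hleB : ∀ K, ∀ τ ∈ T K, νsh' K τ ≤ ν' K τ)
    (hW₀ : RelWeightBound l₀ T (fun K _ τ => A K 0 τ) (fun K _ τ => B K 0 τ) Bad W₀)
    (hSh₀ : ShellWeightBound l₀ T (fun K _ τ => A K 0 τ) (fun K _ τ => B K 0 τ) (fun K _ τ => shA K 0 τ)
      (fun K _ τ => shB K 0 τ) Wsh₀)
    (hlt : ∀ K, W₀ K + Wsh₀ K < 1) (hδ₀ : Summable δ₀)
    (hcore₀ : NE7.Core l₀ vol T Bad (fun K _ τ => A K 0 τ - shA K 0 τ) (fun K _ τ => B K 0 τ - shB K 0 τ) δ₀)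
    (hroom : ∀ K, Real.exp (2 * l₀ * Bo) * (W₀ K + Wsh₀ K) < 1)
    (h : DressedStabilityStrict 𝒯 Λ)
    (hL : ScaleLedger l₀ T Bad F (fun K τ => ν K τ - νsh K τ) F' (fun K τ => ν' K τ - νsh' K τ) wf sc bA bB ΔA ΔB w)
    (wt : ℕ → ι → D → ℝ) (hwt : ∀ K τ, ∀ X ∈ wf K τ, 0 ≤ wt K τ X)
    (hM : ∀ K, ∀ τ ∈ T K, Multiplicity (wf K τ) (sc K) (wt K τ) Cw vol Λ K) (hCw : 0 ≤ Cw)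
    (pA : ℕ → ℝ → ℝ → P) (KA : ℕ → ℕ) (βA : ∀ K (t : ℝ) (τ : ι) (s : ℝ), D → (𝒯.B (pA K t s) (KA K)).Birth)
    (hscA : ∀ K t τ s, ∀ X ∈ wf K τ, KA K - (𝒯.B (pA K t s) (KA K)).birthScale (βA K t τ s X) = K - sc K X)
    (hdomA : ∀ K (t : ℝ), |t| ≤ l₀ → ∀ τ ∈ T K \ Bad K t, ∀ s : ℝ, |s| ≤ l₀ → ∀ X ∈ wf K τ,
      |ΔA K t τ s X| ≤ (𝒯.B (pA K t s) (KA K)).size (βA K t τ s X) (KA K) * wt K τ X)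
    (pB : ℕ → ℝ → ℝ → P) (KB : ℕ → ℕ) (βB : ∀ K (t : ℝ) (τ : ι) (s : ℝ), D → (𝒯.B (pB K t s) (KB K)).Birth)
    (hscB : ∀ K t τ s, ∀ X ∈ wf K τ, KB K - (𝒯.B (pB K t s) (KB K)).birthScale (βB K t τ s X) = K - sc K X)
    (hdomB : ∀ K (t : ℝ), |t| ≤ l₀ → ∀ τ ∈ T K \ Bad K t, ∀ s : ℝ, |s| ≤ l₀ → ∀ X ∈ wf K τ,
      |ΔB K t τ s X| ≤ (𝒯.B (pB K t s) (KB K)).size (βB K t τ s X) (KB K) * wt K τ X)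
    (hY : YoungInfluenceRate l₀ T Bad wf sc ΔA ΔB vol C θ Λ') (hθ : 0 < θ) (hθ1 : θ < 1) (hθΛ' : θ ≤ Λ') (hws : Summable w) :
    ∃ η : ℕ → ℝ, Summable η ∧
      HybridNE7 l₀ vol T A B Bad (fun K => Real.exp (2 * l₀ * Bo) * W₀ K) shA shB
        (fun K => Real.exp (2 * l₀ * Bo) * Wsh₀ K) (fun K => δ₀ K + l₀ / vol * η K) :=
  hybridNE7_dressed_of_n14 hvol hl₀ hA hB hshA hshB hleA hleB (NE7.hybridNE7_of_core hW₀ hSh₀ hlt hδ₀ hcore₀) hroom h hL wt hwt hM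
    hCw pA KA βA hscA hdomA pB KB βB hscB hdomB hY hθ hθ1 hθΛ' hws

end WithN14

/-! ## §3 Readings at the spine carriers of record: `S_N20`, `S_N21`, `S_U4`, and the joint K5 reading on the vacuum ∕ MGF road -/

section Reading

variable {N : ℕ} [NeZero N]

/-- **`S_N20` FROM A VACUUM WEIGHT + MGF READING** [bookkeeping].  If the carrier predicate hands, with every bundle `S` it pins: `0 ≤ S.l₀`; field spaces,
one bounded observable per run (`|Fo K| ≤ Bo`) and class measures putting BOTH runs' dressed term families `S.A`, `S.B` in MGF form; the VACUUM relative
weight bound of the t-idle families `(K, t, τ) ↦ S.A K 0 τ`, `S.B K 0 τ` over `S.T`, `S.Bad` with SOME weight `W₀`; and the record's slot as a pinned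
majorant `e^{2·S.l₀·Bo}·W₀ K ≤ S.W K < 1`, `Summable S.W` — then `YMDAG.UVSplit.S_N20 SRec` (§1's transfer, then `N20Knit.relWeightBound_mono_weight`
BY NAME; the dressed terms are nonnegative as MGFs).  `SRec` a PARAMETER; every conjunct a HYPOTHESIS; NOT NE7b. -/
theorem s_N20_of_vacuumWeightMGFReading (SRec : SpineRecordPred N)
    (hread : ∀ (F : T4Continuum.T4Family) (D : YMDAG.UVSplit.Datum F N) (g₀ : ℕ → ℝ) (os : List (T4Continuum.ULoop F))
      (S : SpineCarriers), SRec F D g₀ os S →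
      0 ≤ S.l₀ ∧
      ∃ (W₀ : ℕ → ℝ) (Ω Ω' : ℕ → Type) (_ : ∀ K, MeasurableSpace (Ω K)) (_ : ∀ K, MeasurableSpace (Ω' K)) (Bo : ℝ)
        (Fo : ∀ K, Ω K → ℝ) (ν : ∀ K, S.ι → Measure (Ω K)) (Fo' : ∀ K, Ω' K → ℝ) (ν' : ∀ K, S.ι → Measure (Ω' K)),
        MGFForm Bo S.T Fo ν S.A ∧ MGFForm Bo S.T Fo' ν' S.B ∧
        RelWeightBound S.l₀ S.T (fun K _ τ => S.A K 0 τ) (fun K _ τ => S.B K 0 τ) S.Bad W₀ ∧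
        (∀ K, Real.exp (2 * S.l₀ * Bo) * W₀ K ≤ S.W K) ∧ (∀ K, S.W K < 1) ∧ Summable S.W) :
    S_N20 SRec := by
  intro F D g₀ os S hS
  obtain ⟨hl₀, W₀, Ω, Ω', _, _, Bo, Fo, ν, Fo', ν', hA, hB, hW₀, hle, h1, hs⟩ := hread F D g₀ os S hS
  have hroom : ∀ K, Real.exp (2 * S.l₀ * Bo) * W₀ K < 1 := fun K => (hle K).trans_lt (h1 K)
  exact relWeightBound_mono_weight (relWeightBound_dressed_of_vacuum_mgfForm hl₀ hA hB hW₀ hroom) hle h1 hs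
    (fun K t _ τ hτ => hA.nonneg' K t hτ) (fun K t _ τ hτ => hB.nonneg' K t hτ)

/-- **`S_N21` FROM A VACUUM SHELL + MGF READING** [bookkeeping].  If the carrier predicate hands, with every bundle `S` it pins: `0 ≤ S.l₀`; field spaces,
one bounded observable per run and class measures putting both runs' dressed term families `S.A`, `S.B` AND their shell parts `S.shA`, `S.shB` in MGF
form, the shell parts over SUB-measures; the VACUUM shell-weight bound of the t-idle families with SOME weight `Wsh₀`; and the record's slot as a pinned
majorant `e^{2·S.l₀·Bo}·Wsh₀ K ≤ S.Wsh K`, `Summable S.Wsh` — then `YMDAG.UVSplit.S_N21 SRec` (§1's transfer, then `N21ShellWeightKnit.shellWeightBound_mono`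
BY NAME).  `SRec` a PARAMETER; every conjunct a HYPOTHESIS; NOT NE7c. -/
theorem s_N21_of_vacuumShellMGFReading (SRec : SpineRecordPred N)
    (hread : ∀ (F : T4Continuum.T4Family) (D : YMDAG.UVSplit.Datum F N) (g₀ : ℕ → ℝ) (os : List (T4Continuum.ULoop F))
      (S : SpineCarriers), SRec F D g₀ os S →
      0 ≤ S.l₀ ∧
      ∃ (Wsh₀ : ℕ → ℝ) (Ω Ω' : ℕ → Type) (_ : ∀ K, MeasurableSpace (Ω K)) (_ : ∀ K, MeasurableSpace (Ω' K)) (Bo : ℝ)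
        (Fo : ∀ K, Ω K → ℝ) (ν νsh : ∀ K, S.ι → Measure (Ω K)) (Fo' : ∀ K, Ω' K → ℝ) (ν' νsh' : ∀ K, S.ι → Measure (Ω' K)),
        MGFForm Bo S.T Fo ν S.A ∧ MGFForm Bo S.T Fo' ν' S.B ∧ MGFForm Bo S.T Fo νsh S.shA ∧ MGFForm Bo S.T Fo' νsh' S.shB ∧
        (∀ K, ∀ τ ∈ S.T K, νsh K τ ≤ ν K τ) ∧ (∀ K, ∀ τ ∈ S.T K, νsh' K τ ≤ ν' K τ) ∧
        ShellWeightBound S.l₀ S.T (fun K _ τ => S.A K 0 τ) (fun K _ τ => S.B K 0 τ) (fun K _ τ => S.shA K 0 τ)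
          (fun K _ τ => S.shB K 0 τ) Wsh₀ ∧
        (∀ K, Real.exp (2 * S.l₀ * Bo) * Wsh₀ K ≤ S.Wsh K) ∧ Summable S.Wsh) :
    S_N21 SRec := by
  intro F D g₀ os S hS
  obtain ⟨hl₀, Wsh₀, Ω, Ω', _, _, Bo, Fo, ν, νsh, Fo', ν', νsh', hA, hB, hshA, hshB, hleA, hleB, hSh₀, hle, hs⟩ :=
    hread F D g₀ os S hS
  exact shellWeightBound_mono (shellWeightBound_dressed_of_vacuum_mgfForm hl₀ hA hB hshA hshB hleA hleB hSh₀) hle hs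

/-- **`S_U4` ON THIS ROAD IS LETTERS** [bookkeeping]: under the `deltaOfRecord` pin of record (every landed N19 reading's), `Summable S.δ` holds BY
CONSTRUCTION (`N19AtSpineCarriers.summable_delta_of_pin` — never progress), so `YMDAG.UVSplit.S_U4 SRec` asks only the booked room `S.W K + S.Wsh K < 1`
of the record's two weight slots.  Displayed for the joint reading below; content-free. -/
theorem s_U4_of_vacuumRoomReading (SRec : SpineRecordPred N)
    (hpin : ∀ (F : T4Continuum.T4Family) (D : YMDAG.UVSplit.Datum F N) (g₀ : ℕ → ℝ) (os : List (T4Continuum.ULoop F))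
      (S : SpineCarriers), SRec F D g₀ os S → letI := S.dec
      S.δ = deltaOfRecord S.l₀ S.vol S.T S.Bad (fun K t τ => S.A K t τ - S.shA K t τ) (fun K t τ => S.B K t τ - S.shB K t τ))
    (hroom : ∀ (F : T4Continuum.T4Family) (D : YMDAG.UVSplit.Datum F N) (g₀ : ℕ → ℝ) (os : List (T4Continuum.ULoop F))
      (S : SpineCarriers), SRec F D g₀ os S → ∀ K, S.W K + S.Wsh K < 1) :
    S_U4 SRec :=
  fun F D g₀ os S hS => ⟨hroom F D g₀ os S hS, summable_delta_of_pin SRec hpin F D g₀ os S hS⟩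

/-- **THE JOINT K5 READING ON THE VACUUM ∕ MGF ROAD** [bookkeeping].  Under the `deltaOfRecord` pin of record, if the carrier predicate and K4's inputs
hand, with every bundle `S`: `0 < S.vol`, `0 ≤ S.l₀`; field spaces, ONE bounded observable per run (`|Fo K| ≤ Bo`) and class measures putting both runs'
dressed term families `S.A`, `S.B` and their shell parts `S.shA`, `S.shB` (over sub-measures) in MGF form; the VACUUM K5 datum of the t-idle families —
N20⁰ `RelWeightBound … W₀`, N21⁰ `ShellWeightBound … Wsh₀`, N19⁰ `Spine.NE7.Core … δ⁰` on the t-idle shell-free cores with `Summable δ⁰` —; N14's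
`TiltedMeanMatching η` on the shell-free measures with `Summable η`; and the record's two weight slots as pinned majorants `e^{2·S.l₀·Bo}·W₀ ≤ S.W`,
`e^{2·S.l₀·Bo}·Wsh₀ ≤ S.Wsh` with the booked room `S.W + S.Wsh < 1` and `Summable S.W`, `Summable S.Wsh` — then ALL FOUR K5 node stubs hold:
`S_N19 SRec Inputs ∧ S_N20 SRec ∧ S_N21 SRec ∧ S_U4 SRec`.  The N19 conjunct is dag-n19-d's `N19VacuumMGFRoad.coreEdge_of_coreZero_mgfForm` on the
shell-free MGF forms (`MGFForm.sub`) read through `N19AtSpineCarriers.s_N19_of_coreEdge`; N20 ∕ N21 ∕ U4′ are the three readings above.  (K4's `Inputs`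
are not consumed on this road: the vacuum `Core` is handed, not produced — its producer is N19's ledger ON THE VACUUM CORES, `N19VacuumMGFRoad` §3.)
`SRec`, `Inputs` PARAMETERS; every conjunct a HYPOTHESIS; NOT NE7 ∕ NE7b ∕ NE7c. -/
theorem k5_of_vacuumK5MGFReading (SRec : SpineRecordPred N) (Inputs : InputsPred N)
    (hpin : ∀ (F : T4Continuum.T4Family) (D : YMDAG.UVSplit.Datum F N) (g₀ : ℕ → ℝ) (os : List (T4Continuum.ULoop F))
      (S : SpineCarriers), SRec F D g₀ os S → letI := S.dec
      S.δ = deltaOfRecord S.l₀ S.vol S.T S.Bad (fun K t τ => S.A K t τ - S.shA K t τ) (fun K t τ => S.B K t τ - S.shB K t τ))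
    (hread : ∀ (F : T4Continuum.T4Family) (D : YMDAG.UVSplit.Datum F N) (g₀ : ℕ → ℝ) (os : List (T4Continuum.ULoop F))
      (S : SpineCarriers), SRec F D g₀ os S → letI := S.dec
      0 < S.vol ∧ 0 ≤ S.l₀ ∧
      ∃ (W₀ Wsh₀ δ₀ η : ℕ → ℝ) (Ω Ω' : ℕ → Type) (_ : ∀ K, MeasurableSpace (Ω K)) (_ : ∀ K, MeasurableSpace (Ω' K)) (Bo : ℝ)
        (Fo : ∀ K, Ω K → ℝ) (ν νsh : ∀ K, S.ι → Measure (Ω K)) (Fo' : ∀ K, Ω' K → ℝ) (ν' νsh' : ∀ K, S.ι → Measure (Ω' K)),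
        (MGFForm Bo S.T Fo ν S.A ∧ MGFForm Bo S.T Fo' ν' S.B ∧ MGFForm Bo S.T Fo νsh S.shA ∧ MGFForm Bo S.T Fo' νsh' S.shB ∧
          (∀ K, ∀ τ ∈ S.T K, νsh K τ ≤ ν K τ) ∧ (∀ K, ∀ τ ∈ S.T K, νsh' K τ ≤ ν' K τ)) ∧
        (RelWeightBound S.l₀ S.T (fun K _ τ => S.A K 0 τ) (fun K _ τ => S.B K 0 τ) S.Bad W₀ ∧
          ShellWeightBound S.l₀ S.T (fun K _ τ => S.A K 0 τ) (fun K _ τ => S.B K 0 τ) (fun K _ τ => S.shA K 0 τ)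
            (fun K _ τ => S.shB K 0 τ) Wsh₀ ∧
          NE7.Core S.l₀ S.vol S.T S.Bad (fun K _ τ => S.A K 0 τ - S.shA K 0 τ) (fun K _ τ => S.B K 0 τ - S.shB K 0 τ) δ₀ ∧
          Summable δ₀) ∧
        (TiltedMeanMatching S.l₀ S.T S.Bad Fo (fun K τ => ν K τ - νsh K τ) Fo' (fun K τ => ν' K τ - νsh' K τ) η ∧ Summable η) ∧
        ((∀ K, Real.exp (2 * S.l₀ * Bo) * W₀ K ≤ S.W K) ∧ (∀ K, Real.exp (2 * S.l₀ * Bo) * Wsh₀ K ≤ S.Wsh K) ∧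
          (∀ K, S.W K + S.Wsh K < 1) ∧ Summable S.W ∧ Summable S.Wsh)) :
    S_N19 SRec Inputs ∧ S_N20 SRec ∧ S_N21 SRec ∧ S_U4 SRec := by
  refine ⟨?_, ?_, ?_, s_U4_of_vacuumRoomReading SRec hpin fun F D g₀ os S hS => ?_⟩
  · -- N19: dag-n19-d's VL-2 reading, fed the shell-free MGF forms (`MGFForm.sub`) and the vacuum `Core`
    refine s_N19_of_vacuumCoreMGFReading SRec Inputs hpin fun F D g₀ os S hS _ => ?_
    obtain ⟨hvol, -, W₀, Wsh₀, δ₀, η, Ω, Ω', mΩ, mΩ', Bo, Fo, ν, νsh, Fo', ν', νsh', ⟨hA, hB, hshA, hshB, hleA, hleB⟩,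
      ⟨-, -, hcore₀, hδ₀⟩, ⟨hη, hηs⟩, -⟩ := hread F D g₀ os S hS
    exact ⟨hvol, δ₀, η, Ω, Ω', mΩ, mΩ', Bo, Fo, fun K τ => ν K τ - νsh K τ, Fo', fun K τ => ν' K τ - νsh' K τ, hcore₀, hδ₀,
      hA.sub hshA hleA, hB.sub hshB hleB, hη, hηs⟩
  · -- N20
    refine s_N20_of_vacuumWeightMGFReading SRec fun F D g₀ os S hS => ?_
    obtain ⟨-, hl₀, W₀, Wsh₀, δ₀, η, Ω, Ω', mΩ, mΩ', Bo, Fo, ν, νsh, Fo', ν', νsh', ⟨hA, hB, -, -, -, -⟩,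
      ⟨hW₀, hSh₀, -, -⟩, -, ⟨hle, hle', hlt, hs, -⟩⟩ := hread F D g₀ os S hS
    exact ⟨hl₀, W₀, Ω, Ω', mΩ, mΩ', Bo, Fo, ν, Fo', ν', hA, hB, hW₀, hle,
      fun K => by linarith [hlt K, hle' K, mul_nonneg (Real.exp_pos (2 * S.l₀ * Bo)).le (hSh₀.nonneg K)], hs⟩
  · -- N21
    refine s_N21_of_vacuumShellMGFReading SRec fun F D g₀ os S hS => ?_
    obtain ⟨-, hl₀, W₀, Wsh₀, δ₀, η, Ω, Ω', mΩ, mΩ', Bo, Fo, ν, νsh, Fo', ν', νsh', ⟨hA, hB, hshA, hshB, hleA, hleB⟩,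
      ⟨-, hSh₀, -, -⟩, -, ⟨-, hle', -, -, hs'⟩⟩ := hread F D g₀ os S hS
    exact ⟨hl₀, Wsh₀, Ω, Ω', mΩ, mΩ', Bo, Fo, ν, νsh, Fo', ν', νsh', hA, hB, hshA, hshB, hleA, hleB, hSh₀, hle', hs'⟩
  · -- U4′'s room letter
    obtain ⟨-, -, W₀, Wsh₀, δ₀, η, Ω, Ω', mΩ, mΩ', Bo, Fo, ν, νsh, Fo', ν', νsh', -, -, -, ⟨-, -, hlt, -, -⟩⟩ := hread F D g₀ os S hS
    exact hlt

end Reading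

end Summit.QuantumFields.YangMills.BalabanUVNodes.N19VacuumK5MGFRoad

end
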